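import Summits.AnomalousDissipation.AnomalousDissipation.Theorems.TaylorGreenLoudGalerkinStates.Negative.LoadBearing
import Literature.Analysis.FunctionSpaces.TorusIntegerEndomorphism

/-!
# Vocabulary and kernel-checked composition of the line `stagnation-plug-froth`
# (crux `MirrorVariety.TaylorGreenLoudGalerkinStates`, stmt-AnomalousDissipation-2987)

Definitions-only support file (plus the sorry-free, CONDITIONAL composition), so that the line's REGISTERED
STUBS — landed one by one as `--supports stmt-AnomalousDissipation-2987` files under `Theorems/` — and the lead's
skeleton (`Cruxes/TaylorGreenLoudGalerkinStates/Lines/stagnation-plug-froth.lean`, not importable) speak about the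
SAME declarations.  The Taylor–Green force `tgForce`, band-limitation `IsBandLimited` and the admissible-state
bracket `IsSteadyState` are REUSED from the landed negative-knowledge file
`Theorems/TaylorGreenLoudGalerkinStates/Negative/LoadBearing.lean` (namespace `….TaylorGreenLoudGalerkinStates.Negative`);
this file adds, in the parent namespace `….Theorems.TaylorGreenLoudGalerkinStates`:

* `reflMat i`, `actVec` — the coordinate reflections `R_i = diag(…,-1,…)` of `T³` (acting on points through the
  tree's `Torus.mulVecT`) and their action on velocity values;
* `IsKSymm u` — equivariance `u (R_i x) = R_i (u x)` under the three reflections (the mirror group `K` of `f_TG`);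
  `IsKField u` — smooth, divergence-free, mean-zero and `K`-symmetric;
* `testedForm ν f U a = ∫ ⟪U,(U·∇)a⟫ + ν⟪U,Δa⟫ + ⟪f,a⟫` — verbatim the tested steady form of the crux
  (`testedForm_eq` : it is the integrand of `Negative.IsSteadyState`), and its linearisation `linForm ν v w a` in `U`
  at `v` in the direction `w`;
* `TaylorGreenLoudGalerkinStates_of` — the composition: the four registered stub STATEMENTS of the line
  (`stub_froth`, `stub_galerkinNewton`, `stub_criticality`, `stub_tgForceRegular`, taken as hypotheses, verbatim)
  imply the crux BY NAME (pure logic: `E := 4E₁`, `ε := ε₁/4`); `line_glue` — the same, curried (the registered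
  sub-goal `line_glue` of the item, through which this file lands `--supports`).

Nothing is asserted unconditionally here except definitional rewrites.  References: the line card
`Cruxes/TaylorGreenLoudGalerkinStates/Lines/stagnation-plug-froth.md`; Brezzi–Rappaz–Raviart, Numer. Math. 36 (1980)
(Galerkin approximation of nonsingular branches); R. Palais, Comm. Math. Phys. 69 (1979) (symmetric criticality);
Temam, *Navier–Stokes Equations* (1979) Ch. II §1 (steady states, tested form (1.25)).
-/

-- `Summit.<Summit>.<Problem>` is the tree's mandated summit-side namespace (CONVENTIONS §2); for this
-- single-conjunct summit the two coincide, so the duplicate is deliberate.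
set_option linter.dupNamespace false

noncomputable section

open scoped BigOperators Topology InnerProductSpace
open Filter MeasureTheory
open Literature.Analysis.FunctionSpaces Literature.Analysis.FunctionSpaces.Torus

namespace Summit.AnomalousDissipation.AnomalousDissipation.Theorems.TaylorGreenLoudGalerkinStates

open Summit.AnomalousDissipation.AnomalousDissipation.Theorems.TaylorGreenLoudGalerkinStates.Negative

/-! ## §1 The mirror group `K` of the Taylor–Green force -/

/-- The reflection matrix `R_i = diag(1,…,-1 (slot i),…,1) ∈ M₃(ℤ)` (`x_i ↦ -x_i` on `T³` via `Torus.mulVecT`).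
[folklore] -/
def reflMat (i : Fin 3) : Matrix (Fin 3) (Fin 3) ℤ :=
  Matrix.diagonal fun k => if k = i then -1 else 1

/-- Action of an integer matrix on velocity values in `ℝ³` (the differential of `Torus.mulVecT M`,
cf. `Torus.mulVecT_proj`). [folklore] -/
def actVec (M : Matrix (Fin 3) (Fin 3) ℤ) (v : EuclideanSpace ℝ (Fin 3)) : EuclideanSpace ℝ (Fin 3) :=
  WithLp.toLp 2 ((M.map (Int.cast : ℤ → ℝ)).mulVec (WithLp.ofLp v))

/-- `K`-symmetry of a vector field on `T³`: equivariance under the three coordinate reflections,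
`u (R_i x) = R_i (u x)` — the mirror group of the Taylor–Green force (Brachet et al. 1983, "impermeable box").
[folklore] -/
def IsKSymm (u : UnitAddTorus (Fin 3) → EuclideanSpace ℝ (Fin 3)) : Prop :=
  ∀ (i : Fin 3) (x : UnitAddTorus (Fin 3)), u (Torus.mulVecT (reflMat i) x) = actVec (reflMat i) (u x)

/-- A `K`-field: smooth, divergence-free, mean-zero and `K`-symmetric. [folklore] -/
def IsKField (u : UnitAddTorus (Fin 3) → EuclideanSpace ℝ (Fin 3)) : Prop :=
  IsSmooth u ∧ IsDivFree u ∧ HasZeroMean u ∧ IsKSymm u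

/-! ## §2 The tested steady form and its linearisation -/

/-- The tested steady Navier–Stokes form of the crux, `∫ ⟪U,(U·∇)a⟫ + ν⟪U,Δa⟫ + ⟪f,a⟫` (zero for all admissible
`a` = `U` is a Galerkin steady state; for a quasi-solution it is the residual paired with `a`; Temam 1979 Ch. II (1.25)
after integration by parts). [folklore] -/
def testedForm (ν : ℝ) (f U a : UnitAddTorus (Fin 3) → EuclideanSpace ℝ (Fin 3)) : ℝ :=
  ∫ x, (inner ℝ (U x) (convect U a x) + ν * inner ℝ (U x) (laplacian a x) + inner ℝ (f x) (a x))

/-- The linearisation of `U ↦ testedForm ν f U a` at `v` in the direction `w` (`U ↦ ⟪U,(U·∇)a⟫` is quadratic):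
`∫ ⟪w,(v·∇)a⟫ + ⟪v,(w·∇)a⟫ + ν⟪w,Δa⟫`. [folklore] -/
def linForm (ν : ℝ) (v w a : UnitAddTorus (Fin 3) → EuclideanSpace ℝ (Fin 3)) : ℝ :=
  ∫ x, (inner ℝ (w x) (convect v a x) + inner ℝ (v x) (convect w a x) + ν * inner ℝ (w x) (laplacian a x))

/-- The admissible-state bracket of `Negative.IsSteadyState` is "`K`-free field data + `testedForm = 0` against every
band-limited smooth div-free test" (definitional). [folklore] -/
theorem isSteadyState_iff (ν : ℝ) (N : ℕ) (f U : UnitAddTorus (Fin 3) → EuclideanSpace ℝ (Fin 3)) :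
    IsSteadyState ν N f U ↔
      IsSmooth U ∧ IsDivFree U ∧ HasZeroMean U ∧ IsBandLimited N U ∧
        ∀ a : UnitAddTorus (Fin 3) → EuclideanSpace ℝ (Fin 3), IsSmooth a → IsDivFree a → IsBandLimited N a →
          testedForm ν f U a = 0 :=
  Iff.rfl

/-! ## §3 Composition: the four registered stubs prove the crux BY NAME -/

/-- **Composition of the line `stagnation-plug-froth` (kernel-checked glue).**  Hypotheses = the four registered stub
statements, verbatim: `hfroth` (Newton-ready `K`-symmetric loud bounded quasi-solutions along `ν_j → 0⁺`, for every
Kantorovich threshold `c > 0`), `hnewton` (Brezzi–Rappaz–Raviart + Newton–Kantorovich: discrete `K`-Galerkin states for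
all large `N`, margins `4E₁`, `ε₁/4`), `hcrit` (symmetric criticality: `K`-tested ⇒ fully tested), `htg` (`f_TG` is a
`K`-field).  Conclusion: the route decl `MirrorVariety.TaylorGreenLoudGalerkinStates`.  Proof: take the threshold `c`
of `hnewton`, the froth family for that `c`, `E := 4E₁`, `ε := ε₁/4`; at each `j`, `hnewton` gives the `K`-Galerkin
states eventually in `N`, `hcrit` upgrades the tested equations, and `f = f_TG` is substituted.  (A CONDITIONAL
result: it credits the item only when all four stubs have landed.) [folklore] -/
theorem TaylorGreenLoudGalerkinStates_of
    (hfroth : ∀ c : ℝ, 0 < c →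
      ∃ (ν : ℕ → ℝ) (v : ℕ → UnitAddTorus (Fin 3) → EuclideanSpace ℝ (Fin 3)) (E₁ ε₁ : ℝ) (η M : ℕ → ℝ),
        (∀ j, 0 < ν j) ∧ Filter.Tendsto ν Filter.atTop (nhds 0) ∧ 0 < ε₁ ∧
        ∀ j, IsKField (v j) ∧ ∫ x, ‖v j x‖ ^ 2 ≤ E₁ ∧ ε₁ ≤ ν j * gradNormSq (v j) ∧
          (∀ a, IsKField a → |testedForm (ν j) tgForce (v j) a| ≤ η j * Real.sqrt (gradNormSq a)) ∧
          (∀ w, IsKField w → ∃ a, IsKField a ∧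
              Real.sqrt (gradNormSq w) * Real.sqrt (gradNormSq a) ≤ M j * linForm (ν j) (v j) w a ∧
              (0 < gradNormSq w → 0 < gradNormSq a)) ∧
          M j ^ 2 * η j ≤ c ∧ (M j * η j) ^ 2 ≤ c * E₁ ∧ ν j * (M j * η j) ^ 2 ≤ c * ε₁)
    (hnewton : ∃ c : ℝ, 0 < c ∧
      ∀ (ν E₁ ε₁ η M : ℝ) (f v : UnitAddTorus (Fin 3) → EuclideanSpace ℝ (Fin 3)),
        0 < ν → IsSmooth f → IsKField v →
        ∫ x, ‖v x‖ ^ 2 ≤ E₁ → ε₁ ≤ ν * gradNormSq v →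
        (∀ a, IsKField a → |testedForm ν f v a| ≤ η * Real.sqrt (gradNormSq a)) →
        (∀ w, IsKField w → ∃ a, IsKField a ∧
            Real.sqrt (gradNormSq w) * Real.sqrt (gradNormSq a) ≤ M * linForm ν v w a ∧
            (0 < gradNormSq w → 0 < gradNormSq a)) →
        M ^ 2 * η ≤ c → (M * η) ^ 2 ≤ c * E₁ → ν * (M * η) ^ 2 ≤ c * ε₁ →
        ∀ᶠ N in Filter.atTop, ∃ U : UnitAddTorus (Fin 3) → EuclideanSpace ℝ (Fin 3),
          IsKField U ∧ IsBandLimited N U ∧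
          (∀ a, IsSmooth a → IsDivFree a → IsKSymm a → IsBandLimited N a → testedForm ν f U a = 0) ∧
          ∫ x, ‖U x‖ ^ 2 ≤ 4 * E₁ ∧ ε₁ / 4 ≤ ν * gradNormSq U)
    (hcrit : ∀ (ν : ℝ) (N : ℕ) (f U : UnitAddTorus (Fin 3) → EuclideanSpace ℝ (Fin 3)),
      IsSmooth f → IsKSymm f → IsKField U → IsBandLimited N U →
      (∀ a, IsSmooth a → IsDivFree a → IsKSymm a → IsBandLimited N a → testedForm ν f U a = 0) →
      ∀ a, IsSmooth a → IsDivFree a → IsBandLimited N a → testedForm ν f U a = 0)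
    (htg : IsKField tgForce) :
    Summit.AnomalousDissipation.AnomalousDissipation.Theses.MirrorVariety.TaylorGreenLoudGalerkinStates := by
  intro f hf
  obtain ⟨c, hc, hN⟩ := hnewton
  obtain ⟨ν, v, E₁, ε₁, η, M, hνpos, hνlim, hε₁, hj⟩ := hfroth c hc
  obtain ⟨htgs, htgd, htgz, htgk⟩ := htg
  refine ⟨ν, 4 * E₁, ε₁ / 4, hνpos, hνlim, by positivity, fun j => ?_⟩
  obtain ⟨hv, hen, hloud, hres, hinf, hs₁, hs₂, hs₃⟩ := hj j
  have hev := hN (ν j) E₁ ε₁ (η j) (M j) tgForce (v j) (hνpos j) htgs hv hen hloud hres hinf hs₁ hs₂ hs₃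
  subst hf
  refine hev.mono ?_
  rintro N ⟨U, hU, hband, htest, hUen, hUloud⟩
  obtain ⟨hUs, hUd, hUz, hUk⟩ := hU
  exact ⟨U, ⟨hUs, hUd, hUz, hband, fun a ha hda hba =>
    hcrit (ν j) N tgForce U htgs htgk ⟨hUs, hUd, hUz, hUk⟩ hband htest a ha hda hba⟩, hUen, hUloud⟩

/-- **Line glue, curried form** (the registered sub-goal `line_glue` of stmt-AnomalousDissipation-2987): the four registered
stub statements of the line `stagnation-plug-froth` imply the crux `MirrorVariety.TaylorGreenLoudGalerkinStates`
(by `TaylorGreenLoudGalerkinStates_of`). [folklore] -/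
theorem line_glue : (∀ c : ℝ, 0 < c → ∃ (ν : ℕ → ℝ) (v : ℕ → UnitAddTorus (Fin 3) → EuclideanSpace ℝ (Fin 3)) (E₁ ε₁ : ℝ) (η M : ℕ → ℝ), (∀ j, 0 < ν j) ∧ Filter.Tendsto ν Filter.atTop (nhds 0) ∧ 0 < ε₁ ∧ ∀ j, IsKField (v j) ∧ ∫ x, ‖v j x‖ ^ 2 ≤ E₁ ∧ ε₁ ≤ ν j * gradNormSq (v j) ∧ (∀ a, IsKField a → |testedForm (ν j) tgForce (v j) a| ≤ η j * Real.sqrt (gradNormSq a)) ∧ (∀ w, IsKField w → ∃ a, IsKField a ∧ Real.sqrt (gradNormSq w) * Real.sqrt (gradNormSq a) ≤ M j * linForm (ν j) (v j) w a ∧ (0 < gradNormSq w → 0 < gradNormSq a)) ∧ M j ^ 2 * η j ≤ c ∧ (M j * η j) ^ 2 ≤ c * E₁ ∧ ν j * (M j * η j) ^ 2 ≤ c * ε₁) → (∃ c : ℝ, 0 < c ∧ ∀ (ν E₁ ε₁ η M : ℝ) (f v : UnitAddTorus (Fin 3) → EuclideanSpace ℝ (Fin 3)), 0 < ν → IsSmooth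 f → IsKField v → ∫ x, ‖v x‖ ^ 2 ≤ E₁ → ε₁ ≤ ν * gradNormSq v → (∀ a, IsKField a → |testedForm ν f v a| ≤ η * Real.sqrt (gradNormSq a)) → (∀ w, IsKField w → ∃ a, IsKField a ∧ Real.sqrt (gradNormSq w) * Real.sqrt (gradNormSq a) ≤ M * linForm ν v w a ∧ (0 < gradNormSq w → 0 < gradNormSq a)) → M ^ 2 * η ≤ c → (M * η) ^ 2 ≤ c * E₁ → ν * (M * η) ^ 2 ≤ c * ε₁ → ∀ᶠ N in Filter.atTop, ∃ U : UnitAddTorus (Fin 3) → EuclideanSpace ℝ (Fin 3), IsKField U ∧ IsBandLimited N U ∧ (∀ a, IsSmooth a → IsDivFree a → IsKSymm a → IsBandLimited N a → testedForm ν f U a = 0) ∧ ∫ x, ‖U x‖ ^ 2 ≤ 4 * E₁ ∧ ε₁ / 4 ≤ ν * gradNormSq U) → (∀ (ν : ℝ) (N : ℕ) (f U : UnitAddTorus (Fin 3) → EuclideanSpace ℝ (Fin 3)), IsSmooth f → IsKSymm f → IsKField U → IsBandLimited N U → (∀ a, IsSmooth a → IsDivFree a → IsKSymm a → IsBandLimited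 N a → testedForm ν f U a = 0) → ∀ a, IsSmooth a → IsDivFree a → IsBandLimited N a → testedForm ν f U a = 0) → IsKField tgForce → Summit.AnomalousDissipation.AnomalousDissipation.Theses.MirrorVariety.TaylorGreenLoudGalerkinStates :=
  fun hfroth hnewton hcrit htg => TaylorGreenLoudGalerkinStates_of hfroth hnewton hcrit htg

end Summit.AnomalousDissipation.AnomalousDissipation.Theorems.TaylorGreenLoudGalerkinStates

end
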